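import Summits.QuantumFields.YangMills.Theorems.BalabanUVNodesN15KingModelCovariantBlockSmallField
import HarnessLib

/-!
# BalabanUVNodes ∕ N15 — THE KING-MODEL RUNG (PART Ϥ-i): PART Ϥ BY NAME — «THE COVARIANT BLOCK TERM AT EVERY LINK FIELD» IN TWO CONJUNCTIONS: the structure of Bałaban's covariant
# block mean `Q(U)` and of King's ∕ Bałaban's full operator `A₀(U) = −cΔ_U + m² + aQ(U)^*Q(U)` at EVERY unitary link field (block formula, `QQ^ᴴ = L^{−(d+1)}`, projection, form identity,
# gauge covariance (3.32)∕(3.34), tree-gauge floor, massless invertibility), and WHAT THE CURVED CASE ADDS for the full propagator ([B9] p.395 l.1–3 decided: every `U` ∕ rough ∕ regular)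
# (Track A, DAG node N15 = NE2; FAN-OUT v1.1 §N15 s3 «KING-MODEL RUNG … + the one-line statement of what the curved case adds»; count-neutral)

HONEST FRAMING.  Count-neutral (cell `pub-ymgap`, seat `pub-ymgap-dag-n15-e` g49; `--supports stmt-QuantumFields-27247 --as helper` = K3ᴬ, KEY MAP v3).  Conjunctions of PARTS Ϥ-a…Ϥ-h by
name; King's comparison model on one finite torus per spacing with one-step covariant averaging over tree contour systems (the comb for the quantitative statements); NOT Bałaban's
multi-level `Q_k(U)`∕`G_k(U)`; NOT (3.42); NOT a node discharge (N15 of record untouched); nothing continuum ∕ ℝ⁴ ∕ OS ∕ Clay.  0 `sorry`, 0 `def`.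
RESULTS: ★★★ **`king_covariant_block_package`** (every tree contour system `T` of depth `≤ D`, every unitary `U`, `c ≥ 0`, every `a`: (1) `(Q(U)v)(y) = treeMean(U(Γ)v)`; (2) `Q(U)Q(U)ᴴ = L^{−(d+1)}·1`;
(3) `P_U² = P_U`; (4) the form identity; (5) `A₀(U^g) = D_gA₀(U)D_g^*`; (6) the tree floor `(m² + min(a, c∕(L^{d+1}D)))Σ‖v_x‖² ≤ Re⟨v,A₀(U)v⟩`), ★★★ **`king_block_what_the_curved_case_adds`**
(comb, King's scaling `c = L²`, massless, `a > 0`, `L ≥ 2`, fibre `ℂⁿ`: (i) at every `U` the full propagator exists with `‖G(U)‖ ≤ treeGap⁻¹`; (ii) at pure gauges `‖G(U)‖ ≤ γ_A⁻¹` for all `L`;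
(iii) some rough `U` has an eigenvalue `≤ 4π²L^{−d}`; (iv) in a small-field gauge (`ε₀∕L`-close to a pure gauge, `ε₀²((d+1)+a(d+1)²) < ½γ_A`) `‖G(U)‖ ≤ (½γ_A − ε₀²((d+1)+a(d+1)²))⁻¹` for all `L`).
PRIOR TREE ART (by name): Ϥ-c (`fib_covQ_mulVec`, `covQ_mul_conjTranspose`), Ϥ-d (`blockProjU_mul_self`, `re_quadForm_fullOpU`, `fullOpU_kingGaugeAct`), Ϥ-e (`re_quadForm_fullOpU_ge_tree`,
`l2_opNorm_fullOpU_massless_inv_le`, `treeGap`), Ϥ-f∕g (`king_flat_vs_rough`, `l2_opNorm_fullOpU_pureGauge_massless_inv_le`), Ϥ-h (`l2_opNorm_fullOpU_massless_inv_le_of_small_field`).  Dedup (rg at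
filing): basename 0 files; needles `king_covariant_block_package|king_block_what_the_curved_case_adds` 0 files.  Locators: [Balaban1985BackgroundPropagators] (3.19) p.393, (3.24) p.394, p.395 l.1–3,
(3.32)∕(3.34) p.395–396, (3.37) p.397; [King1986] (2.11)–(2.13) p.653, (4.5) p.670, (4.33) p.674; [Balaban1984PropagatorsI] (1.7) p.18; [Dimock2013] App. D Lemma 29.
-/

noncomputable section
open scoped BigOperators ComplexConjugate ComplexOrder Matrix.Norms.L2Operator
open Finset Matrix WithLp

namespace Summit.QuantumFields.YangMills.BalabanUVNodes.N15KingModelRung.CovariantBlock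

open Literature.MathematicalPhysics.QuantumFieldTheory.Balaban1983to89.B5Prop11Plancherel (Tor fine unitVec)
open Literature.MathematicalPhysics.QuantumFieldTheory.King1986.Torus (site gamA)
open Summit.QuantumFields.YangMills.BalabanUVNodes.N15KingModelRung.Covariant (kingGaugeMat kingGaugeAct fib)
open Summit.QuantumFields.YangMills.BalabanUVNodes.N15KingModelRung.Curvature (bondE)

variable {d : ℕ} {L : ℕ} [NeZero L] (T : BlockTree d L) (M : Fin (d + 1) → ℕ) [hM : ∀ μ, NeZero (M μ)]
variable {𝕜 : Type*} [RCLike 𝕜] {n : Type*} [Fintype n] [DecidableEq n]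

/-- ★★★ **PART Ϥ BY NAME — THE COVARIANT BLOCK TERM AT EVERY LINK FIELD**: for every tree contour system `T` of depth `≤ D`, every unitary link field `U`, every unitary gauge `g`, `c ≥ 0`,
every `a` and `m²`: (1) the covariant block mean is the mean of the transported field; (2) `Q(U)Q(U)ᴴ = L^{−(d+1)}·1`; (3) `P_U = Q(U)^*Q(U)` is a projection; (4) the form identity
`Re⟨v,A₀(U)v⟩ = m²Σ‖v_x‖² + cΣ bondE + aL^{d+1}Σ‖(Q(U)v)_y‖²`; (5) gauge covariance `A₀(U^g) = D_gA₀(U)D_g^*`; (6) the tree-gauge floor `(m² + min(a, c∕(L^{d+1}D)))Σ‖v_x‖² ≤ Re⟨v,A₀(U)v⟩`.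
[cite: Balaban1985BackgroundPropagators, (3.19) p.393, (3.24) p.394, (3.32) p.395, (3.34) p.396, p.395 l.1–3; King1986, (2.11)–(2.13) p.653; Balaban1984PropagatorsI, (1.7) p.18] -/
theorem king_covariant_block_package {D : ℕ} (hD : ∀ j, T.depth j ≤ D) {c : ℝ} (hc : 0 ≤ c) (a m2 : ℝ)
    {U : Tor (fine L M) × Fin (d + 1) → Matrix n n 𝕜} (hU : ∀ bd, U bd ∈ Matrix.unitaryGroup n 𝕜) {g : Tor (fine L M) → Matrix n n 𝕜} (hg : ∀ x, g x ∈ Matrix.unitaryGroup n 𝕜) :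
    (∀ v y, fib M (covQ T M U *ᵥ v) y = treeMean (𝕜 := 𝕜) (blockTransport T M U v y))
      ∧ covQ T M U * (covQ T M U)ᴴ = ((L : 𝕜) ^ (d + 1))⁻¹ • (1 : Matrix (Tor M × n) (Tor M × n) 𝕜)
      ∧ blockProjU T M U * blockProjU T M U = blockProjU T M U
      ∧ (∀ v, RCLike.re (star v ⬝ᵥ (fullOpU T M a c m2 U *ᵥ v))
          = m2 * ∑ x, ‖fib (fine L M) v x‖ ^ 2 + c * ∑ x, ∑ μ, bondE (fine L M) U v x μ + a * (L : ℝ) ^ (d + 1) * ∑ y, ‖fib M (covQ T M U *ᵥ v) y‖ ^ 2)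
      ∧ fullOpU T M a c m2 (kingGaugeAct (fine L M) g U) = kingGaugeMat (fine L M) g * fullOpU T M a c m2 U * (kingGaugeMat (fine L M) g)ᴴ
      ∧ (∀ v, (m2 + treeGap a c L d D) * ∑ x, ‖fib (fine L M) v x‖ ^ 2 ≤ RCLike.re (star v ⬝ᵥ (fullOpU T M a c m2 U *ᵥ v))) :=
  ⟨fun v y => fib_covQ_mulVec T M U v y, covQ_mul_conjTranspose T M hU, blockProjU_mul_self T M hU, fun v => re_quadForm_fullOpU T M a c m2 hU v,
    fullOpU_kingGaugeAct T M a c m2 hg U, fun v => re_quadForm_fullOpU_ge_tree T M hD hc a m2 hU v⟩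

/-- ★★★ **WHAT THE CURVED CASE ADDS FOR THE FULL PROPAGATOR** (comb contours, King's scaling `c = L² = η⁻²`, massless, `a > 0`, `L ≥ 2`, non-trivial fibre `ℂⁿ`): (i) AT EVERY unitary `U`
the massless full propagator exists with `‖G(U)‖ ≤ min(a, L²∕(L^{d+1}(d+1)(L−1)))⁻¹` (tree gauge; `≍ η^{−d}`); (ii) AT PURE GAUGES `‖G(U)‖ ≤ γ_A⁻¹` for every `L` (King ∕ Dimock by name); (iii)
SOME ROUGH `U` has an eigenvalue `≤ 4π²L^{−d}` — (i)'s order is attained, η-uniformity fails without regularity; (iv) IN A SMALL-FIELD GAUGE (`ε₀∕L`-close to a pure gauge on every bond,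
`ε₀²((d+1) + a(d+1)²) < ½γ_A`) `‖G(U)‖ ≤ (½γ_A − ε₀²((d+1) + a(d+1)²))⁻¹` for every `L` — [B9] p.395 l.1–3 with its «some regularity».
[cite: Balaban1985BackgroundPropagators, p.395 l.1–3, (3.24) p.394, (3.35)–(3.37) p.396–397; King1986, (2.13) p.653, (4.33) p.674; Dimock2013, App. D Lemma 29] -/
theorem king_block_what_the_curved_case_adds {n : Type*} [Fintype n] [DecidableEq n] [Nonempty n] (hL : 2 ≤ L) {a : ℝ} (ha : 0 < a) :
    (∀ U : Tor (fine L M) × Fin (d + 1) → Matrix n n ℂ, (∀ bd, U bd ∈ Matrix.unitaryGroup n ℂ) →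
        ‖(fullOpU (kingComb d L) M a ((L : ℝ) ^ 2) 0 U)⁻¹‖ ≤ (treeGap a ((L : ℝ) ^ 2) L d ((d + 1) * (L - 1)))⁻¹)
      ∧ (∀ g : Tor (fine L M) → Matrix n n ℂ, (∀ x, g x ∈ Matrix.unitaryGroup n ℂ) →
          ‖(fullOpU (kingComb d L) M a ((L : ℝ) ^ 2) 0 (kingGaugeAct (fine L M) g fun _ => (1 : Matrix n n ℂ)))⁻¹‖ ≤ (gamA a (d + 1))⁻¹)
      ∧ (∃ U : Tor (fine L M) × Fin (d + 1) → Matrix n n ℂ, (∀ bd, U bd ∈ Matrix.unitaryGroup n ℂ) ∧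
          ∃ i, (isHermitian_fullOpU (kingComb d L) M a ((L : ℝ) ^ 2) 0 U).eigenvalues i ≤ 4 * Real.pi ^ 2 / (L : ℝ) ^ d)
      ∧ (∀ U : Tor (fine L M) × Fin (d + 1) → Matrix n n ℂ, (∀ bd, U bd ∈ Matrix.unitaryGroup n ℂ) →
          ∀ (g : Tor (fine L M) → Matrix n n ℂ), (∀ x, g x ∈ Matrix.unitaryGroup n ℂ) → ∀ ε₀ : ℝ,
            (∀ bd, ‖U bd - kingGaugeAct (fine L M) g (fun _ => (1 : Matrix n n ℂ)) bd‖ ≤ ε₀ / L) →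
              ε₀ ^ 2 * (((d : ℝ) + 1) + a * ((d : ℝ) + 1) ^ 2) < gamA a (d + 1) / 2 →
                ‖(fullOpU (kingComb d L) M a ((L : ℝ) ^ 2) 0 U)⁻¹‖ ≤ (gamA a (d + 1) / 2 - ε₀ ^ 2 * (((d : ℝ) + 1) + a * ((d : ℝ) + 1) ^ 2))⁻¹) := by
  have hD0 : 0 < (d + 1) * (L - 1) := Nat.mul_pos (Nat.succ_pos d) (by omega)
  have hL0 : (0 : ℝ) < L := by exact_mod_cast (show 0 < L by omega)
  have hc : (0 : ℝ) < (L : ℝ) ^ 2 := pow_pos hL0 2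
  exact ⟨fun U hU => l2_opNorm_fullOpU_massless_inv_le (kingComb d L) M kingComb_depth_le hD0 ha hc hU,
    fun g hg => l2_opNorm_fullOpU_pureGauge_massless_inv_le (kingComb d L) M (by omega) ha hg,
    (king_flat_vs_rough M hL ha).2,
    fun U hU g hg ε₀ hκ hsmall => l2_opNorm_fullOpU_massless_inv_le_of_small_field M (by omega) ha.le hU hg hκ hsmall⟩

end Summit.QuantumFields.YangMills.BalabanUVNodes.N15KingModelRung.CovariantBlock

end
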